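import Summits.Ventures.CertifiedQuantumChemistry.Rows.DeterminantEnergy
import Literature.MathematicalPhysics.QuantumChemistry.SlaterCondonRulesMolecular
import HarnessLib

/-!
# Ventures/CertifiedQuantumChemistry — Rows/CIUpperBound.lean: the Slater–Condon matrix element of `H_F` as an exact rational, and kernel-proved multi-determinant (CI) UPPER rows

HONEST FRAMING (verbatim): certified bounds for a stated model Hamiltonian in a stated basis; not a
claim about the real molecule beyond that model.

Typer (pub-qchem-typer g7, 2026-08-22; zero compute). PART A — the Literature files
`QuantumChemistry/SlaterCondonRules*.lean` (Helgaker–Jørgensen–Olsen §1.4.1–1.4.2, proved) give every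
matrix element `⟨I| Ĥ |J⟩` of the spin-free molecular Hamiltonian between occupation-number vectors.
Here they are mirrored, for a `Model k` (exact-rational integral tables), by ONE computable function
`Model.slaterCondon F I J : ℚ` (`I J : Finset (Orb (Fin k))` = occupied spin orbitals), defined by the
excitation class of the pair — identical (`scDiag`), one replacement (`scSingle`, the general four-sum
form, no integral symmetry assumed), two replacements (`scDouble`), otherwise `0` — with the
Jordan–Wigner phases as rational signs (`jwSignQ`), and the **bridge theorem**
`Model.hamiltonian_apply_eq_slaterCondon : F.hamiltonian I J = ↑(F.slaterCondon I J)` (all `I`, `J`).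

PART B — a sparse trial vector `ψ = Σ_i c_i |D_i⟩` (`CIVec k n`: `n` occupation-number vectors with
rational coefficients; repetitions allowed) has the exact Rayleigh data
`⟨ψ, H_F ψ⟩ = Σ_ij c_i c_j ⟨D_i|H_F|D_j⟩ = CIVec.energy F ψ` and `⟨ψ, ψ⟩ = Σ_ij c_i c_j [D_i = D_j] = CIVec.normSq ψ`,
both rationals the kernel evaluates. **Entry point** `CIVec.upperRow`: for a symmetric model, if every
`D_i` lies in the `(a, b)` sector, `0 < normSq ψ` and `energy F ψ ≤ hi · normSq ψ` — three decidable
statements, closed by `decide +kernel` on literal models — then `UpperRow F a b hi` (Rayleigh–Ritz in the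
sector, `upperRow_of_certificate`). This is the multi-determinant extension of the single-determinant
class of `Rows/DeterminantEnergy.lean` (var-1; its `Model.detEnergy` is the `I = J = |α↑β↓⟩` case in
closed orbital form): no claim node, no external arithmetic, nothing trusted beyond Lean's kernel; the
bound is as good as the trial vector (a selected CI of a few dozen determinants recovers most of the
correlation energy of the k = 10 files: `Certificates/CIUpperN2Sto6g.lean`). Measured kernel cost (farm,
2026-08-22): ≈ 0.08 s per determinant pair at k = 10 (n = 16: ≈ 20 s with `maxHeartbeats 100000000`). A
32-determinant single `decide` (≈ 80 s of kernel work in one declaration) was not reliable across farm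
nodes, so larger vectors are fed **row by row**: `CIVec.upperRow_of_rows` takes per-row bounds
`Σ_j c_i c_j ⟨D_i|H_F|D_j⟩ ≤ r_i` (proved `by intro i; fin_cases i <;> decide +kernel`, one kernel job per
row) and `Σ_i r_i ≤ hi · normSq ψ`. Everything is PROVED (0 sorry).
-/

namespace Summit.Ventures.CertifiedQuantumChemistry

open Matrix Finset
open Literature.MathematicalPhysics.QuantumLattice Literature.MathematicalPhysics.QuantumChemistry

/-! ## Part A — the Slater–Condon mirror and the bridge -/

namespace Model

variable {k : ℕ}

/-! ### ℚ-valued mirrors of the spin-orbital integrals and of the Jordan–Wigner phase -/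

/-- Spin-orbital one-electron integrals of the model over `ℚ`: `h_{pσ,qτ} = δ_στ h_pq` (HJO (2.2.3)). -/
def h1 (F : Model k) (P Q : Orb (Fin k)) : ℚ :=
  if (ofLex P).2 = (ofLex Q).2 then F.h (ofLex P).1 (ofLex Q).1 else 0

/-- Spin-orbital two-electron integrals of the model over `ℚ`: `g_{pσ,qτ,rμ,sν} = δ_στ δ_μν (pq|rs)`
(HJO (2.2.10)). -/
def g2 (F : Model k) (P Q R S : Orb (Fin k)) : ℚ :=
  if (ofLex P).2 = (ofLex Q).2 ∧ (ofLex R).2 = (ofLex S).2 then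
    F.eri (ofLex P).1 (ofLex Q).1 (ofLex R).1 (ofLex S).1 else 0

/-- `spinFreeOne` of the model's (cast) table is the cast of `h1`. -/
theorem spinFreeOne_eq_cast (F : Model k) (P Q : Orb (Fin k)) :
    spinFreeOne (fun p q => (F.h p q : ℂ)) P Q = ((F.h1 P Q : ℚ) : ℂ) := by
  unfold spinFreeOne h1
  split_ifs <;> simp

/-- `spinFreeTwo` of the model's (cast) table is the cast of `g2`. -/
theorem spinFreeTwo_eq_cast (F : Model k) (P Q R S : Orb (Fin k)) :
    spinFreeTwo (fun p q r s => (F.eri p q r s : ℂ)) P Q R S = ((F.g2 P Q R S : ℚ) : ℂ) := by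
  unfold spinFreeTwo g2
  split_ifs <;> simp

/-- The Jordan–Wigner phase `Γ_P^S = (-1)^#{Q ∈ S | Q < P}` as a rational `±1`. -/
def jwSignQ (P : Orb (Fin k)) (S : Finset (Orb (Fin k))) : ℚ := (-1) ^ (S.filter (· < P)).card

/-- `jwSign` is the cast of `jwSignQ`. -/
theorem jwSign_eq_cast (P : Orb (Fin k)) (S : Finset (Orb (Fin k))) :
    jwSign P S = ((jwSignQ P S : ℚ) : ℂ) := by
  simp [jwSign, jwSignQ]

/-! ### The Slater–Condon mirror -/

/-- Identical ON vectors: `⟨J|H_F|J⟩ = Σ_{P∈J} h_PP + ½ Σ_{P,R∈J} (g_PPRR − g_PRRP) + E_core` over `ℚ`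
(HJO (1.4.3) + (1.4.18)). -/
def scDiag (F : Model k) (J : Finset (Orb (Fin k))) : ℚ :=
  ∑ P ∈ J, F.h1 P P + (1 / 2 : ℚ) * ∑ P ∈ J, ∑ R ∈ J, (F.g2 P P R R - F.g2 P R R P) + F.ecore

/-- One replacement (`b ∈ J` emptied, `a ∉ J` filled): the general four-sum form of HJO (1.4.35) with
its phase, over `ℚ` — no permutational symmetry of the integrals is assumed. -/
def scSingle (F : Model k) (J : Finset (Orb (Fin k))) (a b : Orb (Fin k)) : ℚ :=
  jwSignQ b J * jwSignQ a (J.erase b) *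
    (F.h1 a b + (1 / 2 : ℚ) * ∑ R ∈ J,
      ((F.g2 a b R R + F.g2 R R a b) - (F.g2 a R R b + F.g2 R b a R)))

/-- Two replacements (`K, L ∈ D` emptied, `I, J ∉ D` filled): the general form behind HJO (1.4.24) with
the phase of `a†_I a†_J a_L a_K |D⟩`, over `ℚ`. -/
def scDouble (F : Model k) (D : Finset (Orb (Fin k))) (I J K L : Orb (Fin k)) : ℚ :=
  jwSignQ K D * jwSignQ L (D.erase K) * jwSignQ J ((D.erase K).erase L) *
      jwSignQ I (insert J ((D.erase K).erase L)) *
    ((1 / 2 : ℚ) * ((F.g2 I K J L - F.g2 I L J K) - (F.g2 J K I L - F.g2 J L I K)))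

/-- **The Slater–Condon matrix element** `⟨I| H_F |J⟩ ∈ ℚ`, computable by the kernel: by cases on the
excitation class of `(I, J)` — identical; same electron number and `#(J ∖ I) = 1` (one replacement, the
elements of the one-element sets `I ∖ J`, `J ∖ I` read off by a sum); `#(J ∖ I) = #(I ∖ J) = 2` (two
replacements, the elements read off as `min'`/`max'`); otherwise `0` (HJO (1.4.7), (1.4.25)). -/
def slaterCondon (F : Model k) (I J : Finset (Orb (Fin k))) : ℚ :=
  if I = J then F.scDiag J
  else if I.card = J.card ∧ (J \ I).card = 1 then ∑ a ∈ I \ J, ∑ b ∈ J \ I, F.scSingle J a b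
  else if h : 1 < (J \ I).card ∧ 1 < (I \ J).card ∧ (J \ I).card = 2 ∧ I.card = J.card then
    F.scDouble J ((I \ J).min' (card_pos.1 (lt_trans zero_lt_one h.2.1)))
      ((I \ J).max' (card_pos.1 (lt_trans zero_lt_one h.2.1)))
      ((J \ I).min' (card_pos.1 (lt_trans zero_lt_one h.1)))
      ((J \ I).max' (card_pos.1 (lt_trans zero_lt_one h.1)))
  else 0

/-! ### Set bookkeeping for the bridge -/

/-- `#(I ∖ J) = #(J ∖ I)` when `#I = #J`. -/
theorem card_sdiff_eq_card_sdiff {I J : Finset (Orb (Fin k))} (h : I.card = J.card) :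
    (I \ J).card = (J \ I).card := by
  have h1 := card_sdiff_add_card_inter I J
  have h2 := card_sdiff_add_card_inter J I
  rw [inter_comm] at h2
  omega

/-- One replacement: `I ∖ J = {a}`, `J ∖ I = {b}` give `I = J ∖ b ∪ a`. -/
theorem eq_insert_erase_of_sdiff {I J : Finset (Orb (Fin k))} {a b : Orb (Fin k)}
    (ha : I \ J = {a}) (hb : J \ I = {b}) : I = insert a (J.erase b) := by
  ext x
  rw [mem_insert, mem_erase]
  have hxa : x ∈ I \ J ↔ x = a := by rw [ha, mem_singleton]
  have hxb : x ∈ J \ I ↔ x = b := by rw [hb, mem_singleton]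
  rw [mem_sdiff] at hxa hxb
  constructor
  · intro hxI
    by_cases hxJ : x ∈ J
    · exact Or.inr ⟨fun hx => (hxb.2 hx).2 hxI, hxJ⟩
    · exact Or.inl (hxa.1 ⟨hxI, hxJ⟩)
  · rintro (hx | ⟨hxb', hxJ⟩)
    · exact (hxa.2 hx).1
    · by_contra hxI
      exact hxb' (hxb.1 ⟨hxJ, hxI⟩)

/-- Two replacements: `I ∖ J = {I', J'}`, `J ∖ I = {K, L}` give `I = J ∖ {K,L} ∪ {I',J'}`. -/
theorem eq_insert_insert_erase_erase_of_sdiff {I J : Finset (Orb (Fin k))} {I' J' K L : Orb (Fin k)}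
    (ha : I \ J = {I', J'}) (hb : J \ I = {K, L}) :
    I = insert I' (insert J' ((J.erase K).erase L)) := by
  ext x
  rw [mem_insert, mem_insert, mem_erase, mem_erase]
  have hxa : x ∈ I \ J ↔ x = I' ∨ x = J' := by rw [ha, mem_insert, mem_singleton]
  have hxb : x ∈ J \ I ↔ x = K ∨ x = L := by rw [hb, mem_insert, mem_singleton]
  rw [mem_sdiff] at hxa hxb
  constructor
  · intro hxI
    by_cases hxJ : x ∈ J
    · refine Or.inr (Or.inr ⟨fun hx => ?_, fun hx => ?_, hxJ⟩)
      · exact (hxb.2 (Or.inr hx)).2 hxI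
      · exact (hxb.2 (Or.inl hx)).2 hxI
    · rcases hxa.1 ⟨hxI, hxJ⟩ with h | h
      · exact Or.inl h
      · exact Or.inr (Or.inl h)
  · rintro (hx | hx | ⟨hxL, hxK, hxJ⟩)
    · exact (hxa.2 (Or.inl hx)).1
    · exact (hxa.2 (Or.inr hx)).1
    · by_contra hxI
      rcases hxb.1 ⟨hxJ, hxI⟩ with h | h
      · exact hxK h
      · exact hxL h

/-- A two-element set is `{min', max'}`. -/
theorem eq_pair_min'_max' {s : Finset (Orb (Fin k))} (hs : s.card = 2) (hne : s.Nonempty) :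
    s = {s.min' hne, s.max' hne} := by
  symm
  apply eq_of_subset_of_card_le
  · intro x hx
    rw [mem_insert, mem_singleton] at hx
    rcases hx with rfl | rfl
    · exact min'_mem s hne
    · exact max'_mem s hne
  · rw [hs, card_pair (min'_lt_max'_of_card s (by omega)).ne]

/-- **BRIDGE THEOREM.** Every matrix element of `H_F` between occupation-number vectors is the exact
rational `slaterCondon` — by the Literature Slater–Condon rules for `molecularHamiltonian`
(`molecularHamiltonian_apply_self` / `_single_general` / `_double_general` / `_eq_zero_of`). -/
theorem hamiltonian_apply_eq_slaterCondon (F : Model k) (I J : Finset (Orb (Fin k))) :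
    F.hamiltonian I J = ((F.slaterCondon I J : ℚ) : ℂ) := by
  unfold slaterCondon
  by_cases hIJ : I = J
  · subst hIJ
    rw [if_pos rfl, Model.hamiltonian, molecularHamiltonian_apply_self]
    simp only [spinFreeOne_eq_cast, spinFreeTwo_eq_cast, scDiag]
    push_cast
    ring
  rw [if_neg hIJ]
  by_cases h1 : I.card = J.card ∧ (J \ I).card = 1
  · rw [if_pos h1]
    have he : (I \ J).card = 1 := by rw [card_sdiff_eq_card_sdiff h1.1]; exact h1.2
    obtain ⟨b, hb⟩ := card_eq_one.1 h1.2
    obtain ⟨a, ha⟩ := card_eq_one.1 he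
    have hbJ : b ∈ J := (mem_sdiff.1 (hb ▸ mem_singleton_self b)).1
    have haJ : a ∉ J := (mem_sdiff.1 (ha ▸ mem_singleton_self a)).2
    rw [ha, hb, sum_singleton, sum_singleton, eq_insert_erase_of_sdiff ha hb, Model.hamiltonian,
      molecularHamiltonian_apply_single_general _ _ _ hbJ haJ]
    simp only [spinFreeOne_eq_cast, spinFreeTwo_eq_cast, jwSign_eq_cast, scSingle]
    push_cast
    ring
  rw [if_neg h1]
  by_cases h2 : 1 < (J \ I).card ∧ 1 < (I \ J).card ∧ (J \ I).card = 2 ∧ I.card = J.card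
  · rw [dif_pos h2]
    have hd : (J \ I).Nonempty := card_pos.1 (lt_trans zero_lt_one h2.1)
    have he : (I \ J).Nonempty := card_pos.1 (lt_trans zero_lt_one h2.2.1)
    have he2 : (I \ J).card = 2 := by rw [card_sdiff_eq_card_sdiff h2.2.2.2]; exact h2.2.2.1
    set K := (J \ I).min' hd with hKdef
    set L := (J \ I).max' hd with hLdef
    set I' := (I \ J).min' he with hI'def
    set J' := (I \ J).max' he with hJ'def
    have hKL : K < L := min'_lt_max'_of_card _ (by omega)
    have hI'J' : I' < J' := min'_lt_max'_of_card _ (by omega)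
    have hdKL : J \ I = {K, L} := eq_pair_min'_max' h2.2.2.1 hd
    have heIJ : I \ J = {I', J'} := eq_pair_min'_max' he2 he
    have hK : K ∈ J := (mem_sdiff.1 (hdKL ▸ mem_insert_self K _)).1
    have hL : L ∈ J := (mem_sdiff.1 (hdKL ▸ mem_insert_of_mem (mem_singleton_self L))).1
    have hI' : I' ∉ J := (mem_sdiff.1 (heIJ ▸ mem_insert_self I' _)).2
    have hJ' : J' ∉ J := (mem_sdiff.1 (heIJ ▸ mem_insert_of_mem (mem_singleton_self J'))).2
    rw [eq_insert_insert_erase_erase_of_sdiff heIJ hdKL, Model.hamiltonian,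
      molecularHamiltonian_apply_double_general _ _ _ hK hL hKL.ne hI' hJ' hI'J'.ne]
    simp only [spinFreeTwo_eq_cast, jwSign_eq_cast, scDouble]
    push_cast
    ring
  rw [dif_neg h2, Model.hamiltonian, molecularHamiltonian_apply_eq_zero_of, Rat.cast_zero]
  rintro ⟨hc, hle⟩
  have hce := card_sdiff_eq_card_sdiff (k := k) hc
  rcases Nat.lt_or_ge (J \ I).card 1 with h0 | hge
  · -- `J \ I = ∅` with equal cards forces `I = J`
    have hJI : J \ I = ∅ := card_eq_zero.1 (by omega)
    have hIJ' : I \ J = ∅ := card_eq_zero.1 (by omega)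
    exact hIJ (Subset.antisymm (sdiff_eq_empty_iff_subset.1 hIJ') (sdiff_eq_empty_iff_subset.1 hJI))
  · rcases Nat.lt_or_ge 1 (J \ I).card with hgt | hle1
    · exact h2 ⟨hgt, by omega, by omega, hc⟩
    · exact h1 ⟨hc, by omega⟩

end Model

/-! ## Part B — CI trial vectors and their kernel-checkable Rayleigh quotient -/

/-- A sparse trial vector: `n` ON vectors (occupied spin-orbital sets) with rational coefficients. -/
structure CIVec (k n : ℕ) where
  /-- the determinants (need not be distinct) -/
  det : Fin n → Finset (Orb (Fin k))
  /-- their rational coefficients -/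
  coeff : Fin n → ℚ

namespace CIVec

variable {k n : ℕ}

/-- The Fock vector `Σ_i c_i |D_i⟩`. -/
def vec (ψ : CIVec k n) : Fock (Orb (Fin k)) :=
  ∑ i, ((ψ.coeff i : ℚ) : ℂ) • Pi.single (ψ.det i) (1 : ℂ)

/-- `⟨ψ,ψ⟩` as a rational (no distinctness assumed). -/
def normSq (ψ : CIVec k n) : ℚ :=
  ∑ i, ∑ j, if ψ.det i = ψ.det j then ψ.coeff i * ψ.coeff j else 0

/-- `⟨ψ, H_F ψ⟩` as a rational, through the Slater–Condon mirror. -/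
def energy (F : Model k) (ψ : CIVec k n) : ℚ :=
  ∑ i, ∑ j, ψ.coeff i * ψ.coeff j * F.slaterCondon (ψ.det i) (ψ.det j)

/-- All determinants lie in the `(a, b)` sector. -/
def InSector (ψ : CIVec k n) (a b : ℕ) : Prop :=
  ∀ i, (upPart (ψ.det i)).card = a ∧ (downPart (ψ.det i)).card = b

/-- `InSector` is decidable (closed by `decide +kernel` on literal vectors). -/
instance (ψ : CIVec k n) (a b : ℕ) : Decidable (ψ.InSector a b) :=
  inferInstanceAs (Decidable (∀ i, (upPart (ψ.det i)).card = a ∧ (downPart (ψ.det i)).card = b))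

/-- Bilinear expansion `⟨ψ, X ψ⟩ = Σ_ij c_i c_j X_{D_i D_j}`. -/
theorem star_vec_dotProduct_mulVec (ψ : CIVec k n) (X : Matrix (Finset (Orb (Fin k))) (Finset (Orb (Fin k))) ℂ) :
    star ψ.vec ⬝ᵥ X *ᵥ ψ.vec =
      ∑ i, ∑ j, ((ψ.coeff i : ℚ) : ℂ) * ((ψ.coeff j : ℚ) : ℂ) * X (ψ.det i) (ψ.det j) := by
  simp only [vec, star_sum, star_smul, Matrix.mulVec_sum, Matrix.mulVec_smul, sum_dotProduct,
    dotProduct_sum, smul_dotProduct, dotProduct_smul, smul_eq_mul, Model.star_single_dotProduct,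
    mulVec_single_one, col_apply, Finset.mul_sum]
  rw [Finset.sum_comm]
  refine sum_congr rfl fun i _ => sum_congr rfl fun j _ => ?_
  rw [Complex.star_def, map_ratCast]
  ring

/-- `⟨ψ, H_F ψ⟩` is the rational `CIVec.energy`. -/
theorem star_vec_dotProduct_hamiltonian_mulVec (F : Model k) (ψ : CIVec k n) :
    star ψ.vec ⬝ᵥ F.hamiltonian *ᵥ ψ.vec = ((ψ.energy F : ℚ) : ℂ) := by
  rw [star_vec_dotProduct_mulVec, energy]
  push_cast
  simp only [Model.hamiltonian_apply_eq_slaterCondon]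

/-- `⟨ψ, ψ⟩` is the rational `CIVec.normSq`. -/
theorem star_vec_dotProduct_vec (ψ : CIVec k n) : star ψ.vec ⬝ᵥ ψ.vec = ((ψ.normSq : ℚ) : ℂ) := by
  have h := star_vec_dotProduct_mulVec ψ 1
  rw [one_mulVec] at h
  rw [h, normSq]
  push_cast
  refine sum_congr rfl fun i _ => sum_congr rfl fun j _ => ?_
  rw [Matrix.one_apply]
  split_ifs <;> simp

/-- A positive norm makes the trial vector nonzero. -/
theorem vec_ne_zero_of_normSq_pos {ψ : CIVec k n} (h : 0 < ψ.normSq) : ψ.vec ≠ 0 := by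
  intro h0
  have := star_vec_dotProduct_vec ψ
  rw [h0, dotProduct_zero] at this
  have : (ψ.normSq : ℚ) = 0 := by exact_mod_cast this.symm
  exact h.ne' this

/-- Sector-pure determinants give a sector-pure trial vector. -/
theorem isInSector_vec {ψ : CIVec k n} {a b : ℕ} (h : ψ.InSector a b) : IsInSector a b ψ.vec := by
  intro s hs
  simp only [vec, Finset.sum_apply, Pi.smul_apply, smul_eq_mul]
  refine sum_eq_zero fun i _ => ?_
  rw [Pi.single_apply, if_neg, mul_zero]
  rintro rfl
  exact hs (h i)

/-- **KERNEL ENTRY POINT FOR MULTI-DETERMINANT (CI) UPPER CERTIFICATES.** Sector-pure determinants,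
positive norm and `energy ≤ hi · normSq` (three decidable facts) give `UpperCertificate F a b hi`. -/
theorem upperCertificate (F : Model k) (ψ : CIVec k n) {a b : ℕ} {hi : ℚ} (hsec : ψ.InSector a b)
    (hpos : 0 < ψ.normSq) (hle : ψ.energy F ≤ hi * ψ.normSq) : UpperCertificate F a b hi := by
  refine ⟨ψ.vec, isInSector_vec hsec, vec_ne_zero_of_normSq_pos hpos, ?_⟩
  rw [star_vec_dotProduct_hamiltonian_mulVec, star_vec_dotProduct_vec, Complex.ratCast_re,
    Complex.ratCast_re]
  exact_mod_cast hle

/-- **Kernel-proved CI upper row**: the same three facts give `UpperRow F a b hi` for a symmetric model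
(Rayleigh–Ritz in the sector, `upperRow_of_certificate`). -/
theorem upperRow {F : Model k} (hF : F.IsSymmetric) (ψ : CIVec k n) {a b : ℕ} {hi : ℚ}
    (hsec : ψ.InSector a b) (hpos : 0 < ψ.normSq) (hle : ψ.energy F ≤ hi * ψ.normSq) :
    UpperRow F a b hi :=
  upperRow_of_certificate hF (upperCertificate F ψ hsec hpos hle)

/-- Row-by-row feeding of the kernel: per-row bounds `Σ_j c_i c_j sc(D_i, D_j) ≤ r_i` and `Σ_i r_i ≤ c`
give `energy F ψ ≤ c` (one `decide` per row keeps every kernel job at `n` matrix elements). -/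
theorem energy_le_of_rows (F : Model k) (ψ : CIVec k n) (r : Fin n → ℚ) {c : ℚ}
    (hrow : ∀ i, ∑ j, ψ.coeff i * ψ.coeff j * F.slaterCondon (ψ.det i) (ψ.det j) ≤ r i)
    (hsum : ∑ i, r i ≤ c) : ψ.energy F ≤ c :=
  (Finset.sum_le_sum fun i _ => hrow i).trans hsum

/-- **Kernel-proved CI upper row, row by row**: sector purity, positive norm, the per-row bounds and
`Σ_i r_i ≤ hi · normSq` give `UpperRow F a b hi` (use `by intro i; fin_cases i <;> decide +kernel` for
`hrow`, so that each row is its own kernel computation). -/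
theorem upperRow_of_rows {F : Model k} (hF : F.IsSymmetric) (ψ : CIVec k n) (r : Fin n → ℚ) {a b : ℕ}
    {hi : ℚ} (hsec : ψ.InSector a b) (hpos : 0 < ψ.normSq)
    (hrow : ∀ i, ∑ j, ψ.coeff i * ψ.coeff j * F.slaterCondon (ψ.det i) (ψ.det j) ≤ r i)
    (hsum : ∑ i, r i ≤ hi * ψ.normSq) : UpperRow F a b hi :=
  upperRow hF ψ hsec hpos (energy_le_of_rows F ψ r hrow hsum)

end CIVec

end Summit.Ventures.CertifiedQuantumChemistry
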